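import Summits.Ventures.Crystal3D.Theorems.StickyWulffConstantNoReconstructionGainPredSlotBudgetPairs
import Summits.Ventures.Crystal3D.Theorems.StickyWulffConstantNoReconstructionGainPredSlotBudgetRaisedZones
import HarnessLib

/-!
# The pred-slot budget with a raised up bond, at most two contacts: the raised frame in cubic coordinates

HONEST FRAMING. Part of the venture `Summits/Ventures/Crystal3D` (cell `crystal3d-full`), helper
`--supports` the crux `NoReconstructionGain` (stmt-Ventures-19144, route
`route-Ventures-StickyWulffConstant`), line `adhesion` (wulff-p1 g14).  Frame-level core for the brick
`predSlotBudget_of_upBond_raised_le_two` (B1b₂) of skeleton v21 (closed by name in the companion file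
`…PredSlotBudgetRaised`): the pred-slot budget of g13
(`stub_predSlotBudget70`) when one up bond `A·pos_ε(1, −o)` of the grain is `ν`-raised (the band
`54.7°–70.5°` beyond the basal cone) and the ball has AT MOST TWO substrate contacts.  With the landed
B1a (`…PredSlotBudgetCone`, up-triple `ν`-below) this leaves exactly one brick of the g13 budget open:
B1b₃ (raised bond, three contacts).

Method: the rotation by `120°` about the axis (`rot120_bonds`, product of the bond mirrors of `h₁` and
`h₂`) and the half-turn of `…PredSlotBudgetPairs` move the raised bond to `w₃ = pos(1,0,−1)` and the
letter to `+1`; in the cubic coordinates of `…GrainFrameBudgetThree` the raised frame is "region R"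
(`b ≤ a`; mirror-normalised `a + b ≥ 0` by relabelling the coordinates) and the budget is the coordinate
theorem `raisedBudget_one` / `raisedBudget_two` (`…PredSlotBudgetRaisedZones`) with the six credit
propositions of the registered statement, fed slot by slot (`predSlotBudget_coreR_le_two`).

WHAT THIS IS NOT: three contacts with a raised bond (B1b₃, census-certified, lead memo RAISED-g14.md);
the crux on cores; rung F-C1 not moved.
-/

noncomputable section

namespace Summit.Ventures.Crystal3D.Theorems

open Summit.Ventures.Crystal3D Finset
open Literature.MathematicalPhysics.StatisticalMechanics (fccStacking barlowPos constHagg barlowPos_mem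
  threeOffsets barlowPos_apply_zero barlowPos_apply_one barlowPos_apply_two haggLabel_const)
open Literature.Algebra.EuclideanLattices (inner_fin_three norm_sq_fin_three)
open scoped InnerProductSpace

/-! ### The rotation by `120°` about the axis -/

/-- Two vectors of `ℝ³` with equal coordinates are equal. -/
theorem eq_of_apply_fin_three {v w : EuclideanSpace ℝ (Fin 3)} (h0 : v 0 = w 0) (h1 : v 1 = w 1) (h2 : v 2 = w 2) :
    v = w := by
  ext l; fin_cases l
  · exact h0
  · exact h1
  · exact h2

/-- The product `g = r_{h₂} ∘ r_{h₁}` of the bond mirrors of `h₁ = (1,0,0)` and `h₂ = (½, √3/2, 0)`, as a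
formula: the rotation by `120°` about the axis, `(x₀, x₁, x₂) ↦ (−x₀/2 − (√3/2) x₁, (√3/2) x₀ − x₁/2, x₂)`. -/
theorem rot120_apply (x : EuclideanSpace ℝ (Fin 3)) :
    (((ℝ ∙ (barlowPos 1 (Real.sqrt (2 / 3)) constHagg 0 1 0))ᗮ.reflection).trans ((ℝ ∙ (barlowPos 1 (Real.sqrt (2 / 3)) constHagg 0 0 1))ᗮ.reflection)) x 0 = -(1 / 2) * x 0 - Real.sqrt 3 / 2 * x 1 ∧
    (((ℝ ∙ (barlowPos 1 (Real.sqrt (2 / 3)) constHagg 0 1 0))ᗮ.reflection).trans ((ℝ ∙ (barlowPos 1 (Real.sqrt (2 / 3)) constHagg 0 0 1))ᗮ.reflection)) x 1 = Real.sqrt 3 / 2 * x 0 - 1 / 2 * x 1 ∧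
    (((ℝ ∙ (barlowPos 1 (Real.sqrt (2 / 3)) constHagg 0 1 0))ᗮ.reflection).trans ((ℝ ∙ (barlowPos 1 (Real.sqrt (2 / 3)) constHagg 0 0 1))ᗮ.reflection)) x 2 = x 2 := by
  obtain ⟨⟨u0, u1, u2⟩, ⟨v0, v1, v2⟩, -⟩ := bond_coords
  have hu : ‖barlowPos 1 (Real.sqrt (2 / 3)) constHagg 0 1 0‖ = 1 := (bond_mem_and_norm.1).2
  have hv : ‖barlowPos 1 (Real.sqrt (2 / 3)) constHagg 0 0 1‖ = 1 := (bond_mem_and_norm.2.1).2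
  have h3 : Real.sqrt 3 ^ 2 = 3 := Real.sq_sqrt (by norm_num)
  have e1 : ⟪barlowPos 1 (Real.sqrt (2 / 3)) constHagg 0 1 0, x⟫_ℝ = x 0 := by rw [inner_fin_three, u0, u1, u2]; ring
  have e2 : ∀ y : EuclideanSpace ℝ (Fin 3), ⟪barlowPos 1 (Real.sqrt (2 / 3)) constHagg 0 0 1, y⟫_ℝ = 1 / 2 * y 0 + Real.sqrt 3 / 2 * y 1 := by
    intro y; rw [inner_fin_three, v0, v1, v2]; ring
  rw [LinearIsometryEquiv.trans_apply, bondReflection_apply _ _ hu, bondReflection_apply _ _ hv, e2, e1]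
  simp only [PiLp.sub_apply, PiLp.smul_apply, smul_eq_mul, u0, u1, u2, v0, v1, v2]
  refine ⟨by ring, ?_, by ring⟩
  linear_combination (-(x 1) / 2) * h3

/-- The rotation `g` cycles the up bonds `w₁ → w₂ → w₃ → w₁`, permutes the hex bonds up to sign
(`h₁ ↦ −h₃`, `h₂ ↦ −h₁`, `h₃ ↦ h₂`) and fixes `e₃`. -/
theorem rot120_bonds :
    (((ℝ ∙ (barlowPos 1 (Real.sqrt (2 / 3)) constHagg 0 1 0))ᗮ.reflection).trans ((ℝ ∙ (barlowPos 1 (Real.sqrt (2 / 3)) constHagg 0 0 1))ᗮ.reflection)) (barlowPos 1 (Real.sqrt (2 / 3)) constHagg 1 0 0) = barlowPos 1 (Real.sqrt (2 / 3)) constHagg 1 (-1) 0 ∧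
    (((ℝ ∙ (barlowPos 1 (Real.sqrt (2 / 3)) constHagg 0 1 0))ᗮ.reflection).trans ((ℝ ∙ (barlowPos 1 (Real.sqrt (2 / 3)) constHagg 0 0 1))ᗮ.reflection)) (barlowPos 1 (Real.sqrt (2 / 3)) constHagg 1 (-1) 0) = barlowPos 1 (Real.sqrt (2 / 3)) constHagg 1 0 (-1) ∧
    (((ℝ ∙ (barlowPos 1 (Real.sqrt (2 / 3)) constHagg 0 1 0))ᗮ.reflection).trans ((ℝ ∙ (barlowPos 1 (Real.sqrt (2 / 3)) constHagg 0 0 1))ᗮ.reflection)) (barlowPos 1 (Real.sqrt (2 / 3)) constHagg 1 0 (-1)) = barlowPos 1 (Real.sqrt (2 / 3)) constHagg 1 0 0 ∧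
    (((ℝ ∙ (barlowPos 1 (Real.sqrt (2 / 3)) constHagg 0 1 0))ᗮ.reflection).trans ((ℝ ∙ (barlowPos 1 (Real.sqrt (2 / 3)) constHagg 0 0 1))ᗮ.reflection)) (barlowPos 1 (Real.sqrt (2 / 3)) constHagg 0 1 0) = -barlowPos 1 (Real.sqrt (2 / 3)) constHagg 0 1 (-1) ∧
    (((ℝ ∙ (barlowPos 1 (Real.sqrt (2 / 3)) constHagg 0 1 0))ᗮ.reflection).trans ((ℝ ∙ (barlowPos 1 (Real.sqrt (2 / 3)) constHagg 0 0 1))ᗮ.reflection)) (barlowPos 1 (Real.sqrt (2 / 3)) constHagg 0 0 1) = -barlowPos 1 (Real.sqrt (2 / 3)) constHagg 0 1 0 ∧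
    (((ℝ ∙ (barlowPos 1 (Real.sqrt (2 / 3)) constHagg 0 1 0))ᗮ.reflection).trans ((ℝ ∙ (barlowPos 1 (Real.sqrt (2 / 3)) constHagg 0 0 1))ᗮ.reflection)) (barlowPos 1 (Real.sqrt (2 / 3)) constHagg 0 1 (-1)) = barlowPos 1 (Real.sqrt (2 / 3)) constHagg 0 0 1 ∧
    (((ℝ ∙ (barlowPos 1 (Real.sqrt (2 / 3)) constHagg 0 1 0))ᗮ.reflection).trans ((ℝ ∙ (barlowPos 1 (Real.sqrt (2 / 3)) constHagg 0 0 1))ᗮ.reflection)) (EuclideanSpace.single (2 : Fin 3) (1 : ℝ)) = EuclideanSpace.single (2 : Fin 3) (1 : ℝ) := by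
  have h3 : Real.sqrt 3 ^ 2 = 3 := Real.sq_sqrt (by norm_num)
  refine ⟨?_, ?_, ?_, ?_, ?_, ?_, ?_⟩ <;>
    refine eq_of_apply_fin_three (by rw [(rot120_apply _).1]; simp <;> nlinarith [h3])
      (by rw [(rot120_apply _).2.1]; simp <;> ring) (by rw [(rot120_apply _).2.2] <;> simp)

/-! ### The frame-level budget for a raised `w₃` and at most two contacts -/

set_option maxHeartbeats 800000 in
/-- **CORE (raised frame, `#K ≤ 2`).**  In a lattice frame `A` whose axis is within `70.5°` of `−ν` and
whose up bond `A w₃` is `ν`-raised (`⟪A w₃, ν⟫ ≥ 0`), the pred-slot budget holds for at most two contacts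
and hex representatives `g_j = ±A h_j`.  Cubic coordinates and `raisedBudget_one/two`. -/
theorem predSlotBudget_coreR_le_two (A : EuclideanSpace ℝ (Fin 3) ≃ₗᵢ[ℝ] EuclideanSpace ℝ (Fin 3))
    (ν : EuclideanSpace ℝ (Fin 3)) (hν : ‖ν‖ = 1)
    (haxis : ⟪ν, A (EuclideanSpace.single (2 : Fin 3) (1 : ℝ))⟫_ℝ ≤ -(1 / 3)) (t : ℝ)
    (K : Finset (EuclideanSpace ℝ (Fin 3))) (hK : K.card ≤ 2)
    (hK1 : ∀ u ∈ K, ‖u‖ = 1 ∧ ⟪u, ν⟫_ℝ ≤ -t) (hK2 : ∀ u ∈ K, ∀ u' ∈ K, u ≠ u' → ⟪u, u'⟫_ℝ ≤ 1 / 2)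
    (g₁ g₂ g₃ : EuclideanSpace ℝ (Fin 3))
    (hg₁ : g₁ = A (barlowPos 1 (Real.sqrt (2 / 3)) constHagg 0 1 0) ∨ g₁ = -A (barlowPos 1 (Real.sqrt (2 / 3)) constHagg 0 1 0))
    (hg₂ : g₂ = A (barlowPos 1 (Real.sqrt (2 / 3)) constHagg 0 0 1) ∨ g₂ = -A (barlowPos 1 (Real.sqrt (2 / 3)) constHagg 0 0 1))
    (hg₃ : g₃ = A (barlowPos 1 (Real.sqrt (2 / 3)) constHagg 0 1 (-1)) ∨ g₃ = -A (barlowPos 1 (Real.sqrt (2 / 3)) constHagg 0 1 (-1)))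
    (hraised : 0 ≤ ⟪A (barlowPos 1 (Real.sqrt (2 / 3)) constHagg 1 0 (-1)), ν⟫_ℝ) :
    (K.card : ℝ) ≤
      (if (∃ u ∈ K, 1 / 2 < ⟪u, if ⟪g₁, ν⟫_ℝ < 0 then g₁ else -g₁⟫_ℝ) ∨
          ⟪(if ⟪g₁, ν⟫_ℝ < 0 then g₁ else -g₁), ν⟫_ℝ ≤ -t then (1 : ℝ) else 0) +
      (if (∃ u ∈ K, 1 / 2 < ⟪u, if ⟪g₂, ν⟫_ℝ < 0 then g₂ else -g₂⟫_ℝ) ∨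
          ⟪(if ⟪g₂, ν⟫_ℝ < 0 then g₂ else -g₂), ν⟫_ℝ ≤ -t then (1 : ℝ) else 0) +
      (if (∃ u ∈ K, 1 / 2 < ⟪u, if ⟪g₃, ν⟫_ℝ < 0 then g₃ else -g₃⟫_ℝ) ∨
          ⟪(if ⟪g₃, ν⟫_ℝ < 0 then g₃ else -g₃), ν⟫_ℝ ≤ -t then (1 : ℝ) else 0) +
      (if (∃ u ∈ K, 1 / 2 < ⟪u, A (barlowPos 1 (Real.sqrt (2 / 3)) constHagg 1 0 0)⟫_ℝ) ∨ ⟪A (barlowPos 1 (Real.sqrt (2 / 3)) constHagg 1 0 0), ν⟫_ℝ ≤ -t then (1 : ℝ) else 0) +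
      (if (∃ u ∈ K, 1 / 2 < ⟪u, A (barlowPos 1 (Real.sqrt (2 / 3)) constHagg 1 (-1) 0)⟫_ℝ) ∨ ⟪A (barlowPos 1 (Real.sqrt (2 / 3)) constHagg 1 (-1) 0), ν⟫_ℝ ≤ -t then (1 : ℝ) else 0) +
      (if (∃ u ∈ K, 1 / 2 < ⟪u, A (barlowPos 1 (Real.sqrt (2 / 3)) constHagg 1 0 (-1))⟫_ℝ) ∨ ⟪A (barlowPos 1 (Real.sqrt (2 / 3)) constHagg 1 0 (-1)), ν⟫_ℝ ≤ -t then (1 : ℝ) else 0) := by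
  classical
  -- cubic coordinates of the pulled-back normal
  set S := A.symm (-ν) with hSdef
  set a := S 0 + Real.sqrt 3 / 3 * S 1 - Real.sqrt (2 / 3) * S 2 with hadef
  set b := S 0 - Real.sqrt 3 / 3 * S 1 + Real.sqrt (2 / 3) * S 2 with hbdef
  set c := 2 * Real.sqrt 3 / 3 * S 1 + Real.sqrt (2 / 3) * S 2 with hcdef
  have hSn : ‖S‖ = 1 := by rw [hSdef, LinearIsometryEquiv.norm_map, norm_neg, hν]
  have hn : a ^ 2 + b ^ 2 + c ^ 2 = 2 := by
    have h := cubic_inner S S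
    rw [real_inner_self_eq_norm_sq, hSn] at h
    rw [hadef, hbdef, hcdef]; nlinarith [h]
  have hνS : ∀ w : EuclideanSpace ℝ (Fin 3), ⟪A w, ν⟫_ℝ = -⟪w, S⟫_ℝ := by
    intro w
    have : ⟪w, S⟫_ℝ = -⟪A w, ν⟫_ℝ := by
      rw [hSdef, ← A.inner_map_map, LinearIsometryEquiv.apply_symm_apply, inner_neg_right]
    linarith only [this]
  have hdep : ∀ k i j : ℤ, 2 * ⟪A (barlowPos 1 (Real.sqrt (2 / 3)) constHagg k i j), ν⟫_ℝ =
      -(((i : ℝ) + j) * a + ((k : ℝ) + i) * b + ((k : ℝ) + j) * c) := by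
    intro k i j
    have h := inner_barlowPos_cubic k i j S
    rw [← hadef, ← hbdef, ← hcdef] at h
    rw [hνS]; linarith only [h]
  -- the axis condition `−a + b + c ≥ √(2/3)` and the raised bond `b ≤ a`
  have h23 : Real.sqrt (2 / 3) ^ 2 = 2 / 3 := Real.sq_sqrt (by norm_num)
  have hS2 : 1 / 3 ≤ S 2 := by
    have h1 : ⟪ν, A (EuclideanSpace.single (2 : Fin 3) (1 : ℝ))⟫_ℝ = -S 2 := by
      rw [real_inner_comm, hνS, bgf_inner_e3_left]
    linarith only [h1, haxis]
  have hs : Real.sqrt (2 / 3) ≤ -a + b + c := by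
    have : -a + b + c = 3 * Real.sqrt (2 / 3) * S 2 := by rw [hadef, hbdef, hcdef]; ring
    rw [this]; nlinarith [Real.sqrt_nonneg (2 / 3)]
  have hba : b ≤ a := by
    have h := hdep 1 0 (-1)
    push_cast at h
    linarith only [h, hraised]
  -- depths of the six slots
  have dH1 := hdep 0 1 0
  have dH2 := hdep 0 0 1
  have dH3 := hdep 0 1 (-1)
  have dW1 := hdep 1 0 0
  have dW2 := hdep 1 (-1) 0
  push_cast at dH1 dH2 dH3 dW1 dW2
  -- feeding the credit propositions of the statement
  have feedB1p : 0 < a + b → ((∃ u ∈ K, 1 < 2 * ⟪u, A (barlowPos 1 (Real.sqrt (2 / 3)) constHagg 0 1 0)⟫_ℝ) ∨ 2 * t ≤ a + b) →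
      ((∃ u ∈ K, 1 / 2 < ⟪u, if ⟪g₁, ν⟫_ℝ < 0 then g₁ else -g₁⟫_ℝ) ∨
          ⟪(if ⟪g₁, ν⟫_ℝ < 0 then g₁ else -g₁), ν⟫_ℝ ≤ -t) := by
    intro hab h
    have hlt : ⟪A (barlowPos 1 (Real.sqrt (2 / 3)) constHagg 0 1 0), ν⟫_ℝ < 0 := by linarith only [hab, dH1]
    have hlow : (if ⟪g₁, ν⟫_ℝ < 0 then g₁ else -g₁) = A (barlowPos 1 (Real.sqrt (2 / 3)) constHagg 0 1 0) := by
      rcases hg₁ with rfl | rfl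
      · rw [if_pos hlt]
      · rw [if_neg (by rw [inner_neg_left]; linarith only [hlt]), neg_neg]
    rw [hlow]
    rcases h with ⟨u, hu, h⟩ | h
    · exact Or.inl ⟨u, hu, by linarith only [h]⟩
    · exact Or.inr (by linarith only [h, dH1])
  have feedB1m : a + b < 0 → ((∃ u ∈ K, 1 < 2 * ⟪u, -A (barlowPos 1 (Real.sqrt (2 / 3)) constHagg 0 1 0)⟫_ℝ) ∨ 2 * t ≤ -(a + b)) →
      ((∃ u ∈ K, 1 / 2 < ⟪u, if ⟪g₁, ν⟫_ℝ < 0 then g₁ else -g₁⟫_ℝ) ∨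
          ⟪(if ⟪g₁, ν⟫_ℝ < 0 then g₁ else -g₁), ν⟫_ℝ ≤ -t) := by
    intro hab h
    have hgt : 0 < ⟪A (barlowPos 1 (Real.sqrt (2 / 3)) constHagg 0 1 0), ν⟫_ℝ := by linarith only [hab, dH1]
    have hlow : (if ⟪g₁, ν⟫_ℝ < 0 then g₁ else -g₁) = -A (barlowPos 1 (Real.sqrt (2 / 3)) constHagg 0 1 0) := by
      rcases hg₁ with rfl | rfl
      · rw [if_neg (not_lt.2 hgt.le)]
      · rw [if_pos (by rw [inner_neg_left]; linarith only [hgt])]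
    rw [hlow]
    rcases h with ⟨u, hu, h⟩ | h
    · exact Or.inl ⟨u, hu, by linarith only [h]⟩
    · exact Or.inr (by rw [inner_neg_left]; linarith only [h, dH1])
  have feedB2 : 0 < a + c → ((∃ u ∈ K, 1 < 2 * ⟪u, A (barlowPos 1 (Real.sqrt (2 / 3)) constHagg 0 0 1)⟫_ℝ) ∨ 2 * t ≤ a + c) →
      ((∃ u ∈ K, 1 / 2 < ⟪u, if ⟪g₂, ν⟫_ℝ < 0 then g₂ else -g₂⟫_ℝ) ∨
          ⟪(if ⟪g₂, ν⟫_ℝ < 0 then g₂ else -g₂), ν⟫_ℝ ≤ -t) := by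
    intro hac h
    have hlt : ⟪A (barlowPos 1 (Real.sqrt (2 / 3)) constHagg 0 0 1), ν⟫_ℝ < 0 := by linarith only [hac, dH2]
    have hlow : (if ⟪g₂, ν⟫_ℝ < 0 then g₂ else -g₂) = A (barlowPos 1 (Real.sqrt (2 / 3)) constHagg 0 0 1) := by
      rcases hg₂ with rfl | rfl
      · rw [if_pos hlt]
      · rw [if_neg (by rw [inner_neg_left]; linarith only [hlt]), neg_neg]
    rw [hlow]
    rcases h with ⟨u, hu, h⟩ | h
    · exact Or.inl ⟨u, hu, by linarith only [h]⟩
    · exact Or.inr (by linarith only [h, dH2])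
  have feedB3 : b < c → ((∃ u ∈ K, 1 < 2 * ⟪u, -A (barlowPos 1 (Real.sqrt (2 / 3)) constHagg 0 1 (-1))⟫_ℝ) ∨ 2 * t ≤ c - b) →
      ((∃ u ∈ K, 1 / 2 < ⟪u, if ⟪g₃, ν⟫_ℝ < 0 then g₃ else -g₃⟫_ℝ) ∨
          ⟪(if ⟪g₃, ν⟫_ℝ < 0 then g₃ else -g₃), ν⟫_ℝ ≤ -t) := by
    intro hbc h
    have hgt : 0 < ⟪A (barlowPos 1 (Real.sqrt (2 / 3)) constHagg 0 1 (-1)), ν⟫_ℝ := by linarith only [hbc, dH3]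
    have hlow : (if ⟪g₃, ν⟫_ℝ < 0 then g₃ else -g₃) = -A (barlowPos 1 (Real.sqrt (2 / 3)) constHagg 0 1 (-1)) := by
      rcases hg₃ with rfl | rfl
      · rw [if_neg (not_lt.2 hgt.le)]
      · rw [if_pos (by rw [inner_neg_left]; linarith only [hgt])]
    rw [hlow]
    rcases h with ⟨u, hu, h⟩ | h
    · exact Or.inl ⟨u, hu, by linarith only [h]⟩
    · exact Or.inr (by rw [inner_neg_left]; linarith only [h, dH3])
  have feedW1 : ((∃ u ∈ K, 1 < 2 * ⟪u, A (barlowPos 1 (Real.sqrt (2 / 3)) constHagg 1 0 0)⟫_ℝ) ∨ 2 * t ≤ b + c) →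
      ((∃ u ∈ K, 1 / 2 < ⟪u, A (barlowPos 1 (Real.sqrt (2 / 3)) constHagg 1 0 0)⟫_ℝ) ∨ ⟪A (barlowPos 1 (Real.sqrt (2 / 3)) constHagg 1 0 0), ν⟫_ℝ ≤ -t) := by
    rintro (⟨u, hu, h⟩ | h)
    · exact Or.inl ⟨u, hu, by linarith only [h]⟩
    · exact Or.inr (by linarith only [h, dW1])
  have feedW2 : ((∃ u ∈ K, 1 < 2 * ⟪u, A (barlowPos 1 (Real.sqrt (2 / 3)) constHagg 1 (-1) 0)⟫_ℝ) ∨ 2 * t ≤ c - a) →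
      ((∃ u ∈ K, 1 / 2 < ⟪u, A (barlowPos 1 (Real.sqrt (2 / 3)) constHagg 1 (-1) 0)⟫_ℝ) ∨ ⟪A (barlowPos 1 (Real.sqrt (2 / 3)) constHagg 1 (-1) 0), ν⟫_ℝ ≤ -t) := by
    rintro (⟨u, hu, h⟩ | h)
    · exact Or.inl ⟨u, hu, by linarith only [h]⟩
    · exact Or.inr (by linarith only [h, dW2])
  -- nonnegativity of all six credits
  have n₁ : (0 : ℝ) ≤ (if (∃ u ∈ K, 1 / 2 < ⟪u, if ⟪g₁, ν⟫_ℝ < 0 then g₁ else -g₁⟫_ℝ) ∨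
          ⟪(if ⟪g₁, ν⟫_ℝ < 0 then g₁ else -g₁), ν⟫_ℝ ≤ -t then (1 : ℝ) else 0) := by split_ifs <;> norm_num
  have n₂ : (0 : ℝ) ≤ (if (∃ u ∈ K, 1 / 2 < ⟪u, if ⟪g₂, ν⟫_ℝ < 0 then g₂ else -g₂⟫_ℝ) ∨
          ⟪(if ⟪g₂, ν⟫_ℝ < 0 then g₂ else -g₂), ν⟫_ℝ ≤ -t then (1 : ℝ) else 0) := by split_ifs <;> norm_num
  have n₃ : (0 : ℝ) ≤ (if (∃ u ∈ K, 1 / 2 < ⟪u, if ⟪g₃, ν⟫_ℝ < 0 then g₃ else -g₃⟫_ℝ) ∨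
          ⟪(if ⟪g₃, ν⟫_ℝ < 0 then g₃ else -g₃), ν⟫_ℝ ≤ -t then (1 : ℝ) else 0) := by split_ifs <;> norm_num
  have n₄ : (0 : ℝ) ≤ (if (∃ u ∈ K, 1 / 2 < ⟪u, A (barlowPos 1 (Real.sqrt (2 / 3)) constHagg 1 0 0)⟫_ℝ) ∨ ⟪A (barlowPos 1 (Real.sqrt (2 / 3)) constHagg 1 0 0), ν⟫_ℝ ≤ -t then (1 : ℝ) else 0) := by split_ifs <;> norm_num
  have n₅ : (0 : ℝ) ≤ (if (∃ u ∈ K, 1 / 2 < ⟪u, A (barlowPos 1 (Real.sqrt (2 / 3)) constHagg 1 (-1) 0)⟫_ℝ) ∨ ⟪A (barlowPos 1 (Real.sqrt (2 / 3)) constHagg 1 (-1) 0), ν⟫_ℝ ≤ -t then (1 : ℝ) else 0) := by split_ifs <;> norm_num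
  have n₆ : (0 : ℝ) ≤ (if (∃ u ∈ K, 1 / 2 < ⟪u, A (barlowPos 1 (Real.sqrt (2 / 3)) constHagg 1 0 (-1))⟫_ℝ) ∨ ⟪A (barlowPos 1 (Real.sqrt (2 / 3)) constHagg 1 0 (-1)), ν⟫_ℝ ≤ -t then (1 : ℝ) else 0) := by split_ifs <;> norm_num
  -- the number of contacts
  obtain h0 | h1 | h2 : K.card = 0 ∨ K.card = 1 ∨ K.card = 2 := by omega
  · rw [h0, Nat.cast_zero]; linarith only [n₁, n₂, n₃, n₄, n₅, n₆]
  · -- ONE CONTACT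
    obtain ⟨u₁, hKe⟩ := card_eq_one.1 h1
    have m1 : u₁ ∈ K := by rw [hKe]; exact mem_singleton_self _
    obtain ⟨x₁, y₁, z₁, hx₁, hy₁, hz₁, hu₁, hd₁, hb₁⟩ :=
      contact_coords A ν S hSdef a b c hadef hbdef hcdef u₁ (hK1 u₁ m1).1
    have hT₁ : 2 * t ≤ a * x₁ + b * y₁ + c * z₁ := by rw [hd₁]; linarith only [(hK1 u₁ m1).2]
    have c11 := hb₁ 0 1 0; have c12 := hb₁ 0 0 1; have c13 := hb₁ 0 1 (-1)
    have c14 := hb₁ 1 0 0; have c15 := hb₁ 1 (-1) 0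
    push_cast at c11 c12 c13 c14 c15
    rw [h1, Nat.cast_one]
    rcases le_or_gt 0 (a + b) with hab | hab
    · have := raisedBudget_one (T := 2 * t) hn hs hba hab hu₁ hT₁ _ _ _ _ _
        ((∃ u ∈ K, 1 / 2 < ⟪u, A (barlowPos 1 (Real.sqrt (2 / 3)) constHagg 1 0 (-1))⟫_ℝ) ∨ ⟪A (barlowPos 1 (Real.sqrt (2 / 3)) constHagg 1 0 (-1)), ν⟫_ℝ ≤ -t)
        (fun h0 h => feedB1p h0 (h.elim (fun e => Or.inl ⟨u₁, m1, by linarith only [e, c11, c12, c13, c14, c15]⟩) Or.inr))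
        (fun h0 h => feedB2 h0 (h.elim (fun e => Or.inl ⟨u₁, m1, by linarith only [e, c11, c12, c13, c14, c15]⟩) Or.inr))
        (fun h0 h => feedB3 h0 (h.elim (fun e => Or.inl ⟨u₁, m1, by rw [inner_neg_right]; linarith only [e, c11, c12, c13, c14, c15]⟩) Or.inr))
        (fun h => feedW1 (h.elim (fun e => Or.inl ⟨u₁, m1, by linarith only [e, c11, c12, c13, c14, c15]⟩) Or.inr))
        (fun h => feedW2 (h.elim (fun e => Or.inl ⟨u₁, m1, by linarith only [e, c11, c12, c13, c14, c15]⟩) Or.inr))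
      linarith only [this]
    · -- mirrored coordinates `(x, y, z) ↦ (−y, −x, z)`, `(a, b, c) ↦ (−b, −a, c)`
      have := raisedBudget_one (a := -b) (b := -a) (c := c) (T := 2 * t) (x := -y₁) (y := -x₁) (z := z₁)
        (by linarith only [hn]) (by linarith only [hs]) (by linarith only [hba]) (by linarith only [hab])
        (by linarith only [hu₁]) (by linarith only [hT₁]) _ _ _ _ _
        ((∃ u ∈ K, 1 / 2 < ⟪u, A (barlowPos 1 (Real.sqrt (2 / 3)) constHagg 1 0 (-1))⟫_ℝ) ∨ ⟪A (barlowPos 1 (Real.sqrt (2 / 3)) constHagg 1 0 (-1)), ν⟫_ℝ ≤ -t)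
        (fun h0 h => feedB1m hab (h.elim (fun e => Or.inl ⟨u₁, m1, by rw [inner_neg_right]; linarith only [e, c11, c12, c13, c14, c15]⟩)
          (fun e => Or.inr (by linarith only [e]))))
        (fun h0 h => feedB3 (by linarith only [h0]) (h.elim (fun e => Or.inl ⟨u₁, m1, by rw [inner_neg_right]; linarith only [e, c11, c12, c13, c14, c15]⟩)
          (fun e => Or.inr (by linarith only [e]))))
        (fun h0 h => feedB2 (by linarith only [h0]) (h.elim (fun e => Or.inl ⟨u₁, m1, by linarith only [e, c11, c12, c13, c14, c15]⟩)
          (fun e => Or.inr (by linarith only [e]))))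
        (fun h => feedW2 (h.elim (fun e => Or.inl ⟨u₁, m1, by linarith only [e, c11, c12, c13, c14, c15]⟩) (fun e => Or.inr (by linarith only [e]))))
        (fun h => feedW1 (h.elim (fun e => Or.inl ⟨u₁, m1, by linarith only [e, c11, c12, c13, c14, c15]⟩) (fun e => Or.inr (by linarith only [e]))))
      linarith only [this]
  · -- TWO CONTACTS
    obtain ⟨u₁, u₂, n12, hKe⟩ := card_eq_two.1 h2
    have m1 : u₁ ∈ K := by rw [hKe]; simp only [mem_insert, mem_singleton, true_or]
    have m2 : u₂ ∈ K := by rw [hKe]; simp only [mem_insert, mem_singleton, or_true]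
    obtain ⟨x₁, y₁, z₁, hx₁, hy₁, hz₁, hu₁, hd₁, hb₁⟩ :=
      contact_coords A ν S hSdef a b c hadef hbdef hcdef u₁ (hK1 u₁ m1).1
    obtain ⟨x₂, y₂, z₂, hx₂, hy₂, hz₂, hu₂, hd₂, hb₂⟩ :=
      contact_coords A ν S hSdef a b c hadef hbdef hcdef u₂ (hK1 u₂ m2).1
    have hT₁ : 2 * t ≤ a * x₁ + b * y₁ + c * z₁ := by rw [hd₁]; linarith only [(hK1 u₁ m1).2]
    have hT₂ : 2 * t ≤ a * x₂ + b * y₂ + c * z₂ := by rw [hd₂]; linarith only [(hK1 u₂ m2).2]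
    have h12 : x₁ * x₂ + y₁ * y₂ + z₁ * z₂ ≤ 1 := by
      rw [contact_pair A u₁ u₂ hx₁ hy₁ hz₁ hx₂ hy₂ hz₂]; linarith only [hK2 u₁ m1 u₂ m2 n12]
    have c11 := hb₁ 0 1 0; have c12 := hb₁ 0 0 1; have c13 := hb₁ 0 1 (-1)
    have c14 := hb₁ 1 0 0; have c15 := hb₁ 1 (-1) 0
    have c21 := hb₂ 0 1 0; have c22 := hb₂ 0 0 1; have c23 := hb₂ 0 1 (-1)
    have c24 := hb₂ 1 0 0; have c25 := hb₂ 1 (-1) 0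
    push_cast at c11 c12 c13 c14 c15 c21 c22 c23 c24 c25
    rw [h2, Nat.cast_ofNat]
    rcases le_or_gt 0 (a + b) with hab | hab
    · have := raisedBudget_two (T := 2 * t) hn hs hba hab hu₁ hT₁ hu₂ hT₂ h12 _ _ _ _ _
        ((∃ u ∈ K, 1 / 2 < ⟪u, A (barlowPos 1 (Real.sqrt (2 / 3)) constHagg 1 0 (-1))⟫_ℝ) ∨ ⟪A (barlowPos 1 (Real.sqrt (2 / 3)) constHagg 1 0 (-1)), ν⟫_ℝ ≤ -t)
        (fun h0 h => feedB1p h0 (h.elim (fun e => Or.inl ⟨u₁, m1, by linarith only [e, c11, c12, c13, c14, c15]⟩)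
          (fun h => h.elim (fun e => Or.inl ⟨u₂, m2, by linarith only [e, c21, c22, c23, c24, c25]⟩) Or.inr)))
        (fun h0 h => feedB2 h0 (h.elim (fun e => Or.inl ⟨u₁, m1, by linarith only [e, c11, c12, c13, c14, c15]⟩)
          (fun h => h.elim (fun e => Or.inl ⟨u₂, m2, by linarith only [e, c21, c22, c23, c24, c25]⟩) Or.inr)))
        (fun h0 h => feedB3 h0 (h.elim (fun e => Or.inl ⟨u₁, m1, by rw [inner_neg_right]; linarith only [e, c11, c12, c13, c14, c15]⟩)
          (fun h => h.elim (fun e => Or.inl ⟨u₂, m2, by rw [inner_neg_right]; linarith only [e, c21, c22, c23, c24, c25]⟩) Or.inr)))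
        (fun h => feedW1 (h.elim (fun e => Or.inl ⟨u₁, m1, by linarith only [e, c11, c12, c13, c14, c15]⟩)
          (fun h => h.elim (fun e => Or.inl ⟨u₂, m2, by linarith only [e, c21, c22, c23, c24, c25]⟩) Or.inr)))
        (fun h => feedW2 (h.elim (fun e => Or.inl ⟨u₁, m1, by linarith only [e, c11, c12, c13, c14, c15]⟩)
          (fun h => h.elim (fun e => Or.inl ⟨u₂, m2, by linarith only [e, c21, c22, c23, c24, c25]⟩) Or.inr)))
      linarith only [this]
    · have := raisedBudget_two (a := -b) (b := -a) (c := c) (T := 2 * t)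
        (x₁ := -y₁) (y₁ := -x₁) (z₁ := z₁) (x₂ := -y₂) (y₂ := -x₂) (z₂ := z₂)
        (by linarith only [hn]) (by linarith only [hs]) (by linarith only [hba]) (by linarith only [hab])
        (by linarith only [hu₁]) (by linarith only [hT₁]) (by linarith only [hu₂]) (by linarith only [hT₂])
        (by linarith only [h12]) _ _ _ _ _
        ((∃ u ∈ K, 1 / 2 < ⟪u, A (barlowPos 1 (Real.sqrt (2 / 3)) constHagg 1 0 (-1))⟫_ℝ) ∨ ⟪A (barlowPos 1 (Real.sqrt (2 / 3)) constHagg 1 0 (-1)), ν⟫_ℝ ≤ -t)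
        (fun h0 h => feedB1m hab (h.elim (fun e => Or.inl ⟨u₁, m1, by rw [inner_neg_right]; linarith only [e, c11, c12, c13, c14, c15]⟩)
          (fun h => h.elim (fun e => Or.inl ⟨u₂, m2, by rw [inner_neg_right]; linarith only [e, c21, c22, c23, c24, c25]⟩)
            (fun e => Or.inr (by linarith only [e])))))
        (fun h0 h => feedB3 (by linarith only [h0]) (h.elim (fun e => Or.inl ⟨u₁, m1, by rw [inner_neg_right]; linarith only [e, c11, c12, c13, c14, c15]⟩)
          (fun h => h.elim (fun e => Or.inl ⟨u₂, m2, by rw [inner_neg_right]; linarith only [e, c21, c22, c23, c24, c25]⟩)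
            (fun e => Or.inr (by linarith only [e])))))
        (fun h0 h => feedB2 (by linarith only [h0]) (h.elim (fun e => Or.inl ⟨u₁, m1, by linarith only [e, c11, c12, c13, c14, c15]⟩)
          (fun h => h.elim (fun e => Or.inl ⟨u₂, m2, by linarith only [e, c21, c22, c23, c24, c25]⟩) (fun e => Or.inr (by linarith only [e])))))
        (fun h => feedW2 (h.elim (fun e => Or.inl ⟨u₁, m1, by linarith only [e, c11, c12, c13, c14, c15]⟩)
          (fun h => h.elim (fun e => Or.inl ⟨u₂, m2, by linarith only [e, c21, c22, c23, c24, c25]⟩) (fun e => Or.inr (by linarith only [e])))))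
        (fun h => feedW1 (h.elim (fun e => Or.inl ⟨u₁, m1, by linarith only [e, c11, c12, c13, c14, c15]⟩)
          (fun h => h.elim (fun e => Or.inl ⟨u₂, m2, by linarith only [e, c21, c22, c23, c24, c25]⟩) (fun e => Or.inr (by linarith only [e])))))
      linarith only [this]

end Summit.Ventures.Crystal3D.Theorems

end
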